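import Summits.Schanuel.Schanuel.Theorems.RootDecomp1KXLinear02

/-!
# RootDecomp1KXLinear — lens 1, generation 45, node 2 (g45b) «X-LINEAR THIN FIBRE: ALL CURVES A(Y) + x·B(Y) WITH deg B < deg A, HYPOTHESIS-FREE» (RULE K-R31 (ii) second clause + K-R32 (i); CLAIM L2261, ACK/CHECKLIST K-g45b L2262, NODE L2274 / REQUEST L2275, critic VERDICT L2278: CLEARED — THEOREM ×2; port shape L2282 (d)) — continuation (RootDecomp1KXLinear03): §X part 2 — 2-adic infrastructure (ii)

(lens-1 g45b HOME kernel K₂ = HOME/decomp-schanuel-lens-1/g45b/DLxlinear.lean db54a0a5…, 3838 l = the DegreeLadder ed. 3 prefix (tree: RootDecomp1KDegreeLadder01–09) + `XLinearCore` (l.2184–2562) + §X (l.2564–3836); imports SkelCell01 + Literature RidoutIntegers (BUILT on the farm since 20:13Z). Port by census-1 gen 19 as `RootDecomp1KXLinear01`–`05`: 01 = XLinearCore (namespace `…RootDecomp1KXLinearCore`; the 2-adic CORE LEMMA `core` — second-order approximation of the nearest e-th root by the rationally shifted point — `roots_structure`, and Step 5 `ridout_step` with `Ridout.padicRoth_int`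 BY TREE NAME; imports tree DegreeLadder08 + Literature RidoutIntegers); 02–05 = §X (namespace `…RootDecomp1KXLinear`): 02 = `xLinP`, `gap`, level points `OnLevel`, Steps 1a/1b/2/6, 2-adic infrastructure (first half); 03 = 2-adic infrastructure (second half: the shifted integer, valuation bookkeeping); 04 = the composition `levels_finite` → `thinFibreAt_xLinP` (scoped `maxHeartbeats 800000` ×2 as in K) + common rational roots; 05 = pole gap e = 1 `thinFibreAt_xLinP_gapOne` (no Ridout), `thinFibreAt_xLinear`, `thinFibreAt_xLinear_of_lt`, the typed classes `XLinearGap2` / `XLinearLt` with `thinFibreAt_of_xLinearGap2` / `thinFibreAt_of_xLinearLt` / `thinFibreAt_sqMulP'` (all c ≠ 0), positions and non-members (`not_xLinearGap2_lineP`, `cuspP`), the consumer `xLinear_nonvanishing (hm : 2 ≤ m) (hρ : SkelLiouvilleFix m ρ) (A B) (hB : B ≠ 0) (hlt : B.natDegree < A.natDegree) : aeval ρ A + liouvilleNumber 2 * aeval ρ B ≠ 0` — ALL HYPOTHESIS-FREE.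
PORT EDITS (critic L2282 (d)): the DegreeLadder prefix dropped (tree parts imported); the `(hR : PadicRothInt)` binder REMOVED from the ten decls that carried it and `Literature.NumberTheory.DiophantineApproximation.Ridout.padicRoth_int` fed directly at the one use site in `ridout_step`; the §HypFree primed twins and `padicRothInt_holds` DROPPED (the unprimed names now denote the binder-free forms); `open …DegreeLadder (PadicRothInt pTwo)` ↦ `(pTwo)`; two linter options dropped; 22 one-line docstrings added; seven generic p-adic/arithmetic helpers private (`norm_natCast_le_one`, `norm_two`, `norm_two_pow`, `norm_intCast_le_one'`, `factorial_sub_ge`, `natDegree_linear`, `den_dvd_leadingCoeff` — dedup-safety vs DegreeLadder08's private 2-adic lemmas) with per-part private copies, plus private copies of the DegreeLadder port's private ℓ₂/psNumer lemmas where §X uses them; statements and proofs otherwise verbatim. `--supports stmt-Schanuel-33364`; no census credit carried; rung 0 — nothing here proves Schanuel; `ThinFibre m₀` (all curves) stays OPEN / IDEA-NEEDED.)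
-/

noncomputable section

namespace Summit.Schanuel.Schanuel.Theorems.RootDecomp1KXLinear

open Polynomial LiouvilleNumber
open scoped Nat
open Summit.Schanuel.Schanuel.Theorems.RootDecomp1KSkelCell
  (exists_le_two_pow_factorial iota iota_spec iota_le_of_le pow_lt_of_lt_iota lt_iota_of_pow_lt iota_mono
   one_le_iota SkelLiouville SkelLiouvilleFix skelLiouville_iff_fix SkelLiouvilleFix.mono uStar dU rU dU_cast
   two_pow_le_four_mul_dU two_mul_dU_lt one_le_dU rU_den rU_cast uStar_sub_rU skelLiouvilleFix_one_uStar
   not_skelFixOne_algebraicIndependent)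
open Summit.Schanuel.Schanuel.Theorems.RootDecomp1KTwoBaseCell (psNumer partialSum_eq_psNumer_div coprime_psNumer
  algebraicIndependent_of_forall_int')
open Summit.Schanuel.Schanuel.Theorems.RootDecomp1KRelLiouvilleCell (partialSum_two_strictMono
  partialSum_two_lt_liouvilleNumber abs_liouvilleNumber_two_sub_partialSum)
open Summit.Schanuel.Schanuel.Theorems.RootDecomp1KDegreeLadder
open Summit.Schanuel.Schanuel.Theorems.RootDecomp1KXLinearCore (core ridout_step)

/-- `ℓ₂ := liouvilleNumber 2`. -/
private theorem ell2_eq (N : ℕ) : liouvilleNumber 2 = partialSum 2 N + remainder 2 N :=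
  (partialSum_add_remainder (by norm_num) N).symm

/-- `s_N = p_N / 2^{N!}` (tree `partialSum_eq_psNumer_div` at `b = 2`). -/
private theorem partialSum_two (N : ℕ) : partialSum 2 N = (psNumer 2 N : ℝ) / (2 : ℝ) ^ N ! := by
  have := partialSum_eq_psNumer_div (b := 2) (by norm_num) N
  simpa using this

/-- `1/2^{(N+1)!} ≤ ℓ₂ − s_N < 2/2^{(N+1)!}`. -/
private theorem remainder_two_lt (N : ℕ) : remainder 2 N < 2 / (2 : ℝ) ^ (N + 1)! := by
  have h := remainder_lt' N (m := (2 : ℝ)) (by norm_num)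
  have e : (1 - 1 / (2 : ℝ))⁻¹ * (1 / 2 ^ (N + 1)!) = 2 / (2 : ℝ) ^ (N + 1)! := by
    rw [div_eq_mul_inv (2 : ℝ) (2 ^ (N + 1)!), one_div]
    norm_num
  linarith [h, e]

/-- `|m|₂ = 2^{−v₂(m)}` for a non-zero integer `m`, in `\overline{ℚ₂}` (the norm of `PadicAlgCl 2` extends that of
`ℚ_[2]`; cf. `Literature.NumberTheory.DiophantineApproximation.norm_intCast_padicAlgCl`). -/
private theorem norm_intCast_padicAlgCl_two {m : ℤ} (hm : m ≠ 0) :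
    ‖(m : PadicAlgCl 2)‖ = (2 : ℝ) ^ (-(padicValInt 2 m : ℤ)) := by
  have h1 : (m : PadicAlgCl 2) = algebraMap ℚ_[2] (PadicAlgCl 2) (m : ℚ_[2]) := (map_intCast _ m).symm
  rw [h1, PadicAlgCl.norm_extends, Padic.norm_eq_zpow_neg_valuation (by exact_mod_cast hm),
    Padic.valuation_intCast]
  norm_num

/-- `(M+1)! − M! = M·M!`. -/
private theorem factorial_succ_sub (M : ℕ) : (M + 1)! - M ! = M * M ! := by
  rw [Nat.factorial_succ, Nat.succ_mul]; omega

/-- `p_M` is odd for `M ≥ 2`. -/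
private theorem psNumer_two_odd {M : ℕ} (hM : 2 ≤ M) : Odd (psNumer 2 M) := by
  have h := coprime_psNumer_two_pow hM 1
  rw [pow_one] at h
  have h2 : ¬ 2 ∣ psNumer 2 M := (Nat.Prime.coprime_iff_not_dvd Nat.prime_two).mp h
  exact Nat.odd_iff.mpr (Nat.two_dvd_ne_zero.mp h2)

/-- `|m|₂ = 1` for an odd integer `m`, in `\overline{ℚ₂}`. -/
private theorem norm_intCast_of_odd {m : ℤ} (hm : Odd m) : ‖(m : PadicAlgCl 2)‖ = 1 := by
  have hm0 : m ≠ 0 := by rintro rfl; exact (Int.not_even_iff_odd.mpr hm) ⟨0, rfl⟩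
  rw [norm_intCast_padicAlgCl_two hm0]
  have h2 : ¬ ((2 : ℕ) : ℤ) ∣ m := by
    intro h
    exact (Int.not_even_iff_odd.mpr hm) (even_iff_two_dvd.mpr (by exact_mod_cast h))
  rw [padicValInt.eq_zero_of_not_dvd h2]
  simp

/-- `‖(n : \overline{ℚ₂})‖ ≤ 1`. -/
private theorem norm_natCast_le_one (n : ℕ) : ‖(n : PadicAlgCl 2)‖ ≤ 1 := by
  have h1 : (n : PadicAlgCl 2) = algebraMap ℚ_[2] (PadicAlgCl 2) (n : ℚ_[2]) := (map_natCast _ n).symm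
  rw [h1, PadicAlgCl.norm_extends]
  have h2 : ((n : ℤ_[2]) : ℚ_[2]) = (n : ℚ_[2]) := by simp
  rw [← h2]
  exact PadicInt.norm_le_one _

/-- `‖2‖₂ = 1/2` in `PadicAlgCl 2`. -/
private theorem norm_two : ‖(2 : PadicAlgCl 2)‖ = 1 / 2 := by
  have h1 : ((2 : ℕ) : PadicAlgCl 2) = algebraMap ℚ_[2] (PadicAlgCl 2) ((2 : ℕ) : ℚ_[2]) :=
    (map_natCast _ 2).symm
  have h2 : ‖((2 : ℕ) : ℚ_[2])‖ = (↑(2 : ℕ) : ℝ)⁻¹ := Padic.norm_p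
  have h3 : ‖((2 : ℕ) : PadicAlgCl 2)‖ = 1 / 2 := by rw [h1, PadicAlgCl.norm_extends, h2]; norm_num
  simpa using h3

/-- `‖(z : \overline{ℚ₂})‖ ≤ 1` for integers. -/
private theorem norm_intCast_le_one' (z : ℤ) : ‖(z : PadicAlgCl 2)‖ ≤ 1 := by
  have h1 : (z : PadicAlgCl 2) = algebraMap ℚ_[2] (PadicAlgCl 2) (z : ℚ_[2]) := (map_intCast _ z).symm
  rw [h1, PadicAlgCl.norm_extends]
  exact Padic.norm_int_le_one z

/-- `‖p_N − 1‖₂ ≤ 2^{−(N! − (N−1)!)}`. -/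
theorem norm_psNumer_sub_one {N : ℕ} (hN : 1 ≤ N) :
    ‖(psNumer 2 N : PadicAlgCl 2) - 1‖ ≤ (1 / 2 : ℝ) ^ (Nat.factorial N - Nat.factorial (N - 1)) := by
  obtain ⟨M, rfl⟩ : ∃ M, N = M + 1 := ⟨N - 1, by omega⟩
  rw [Nat.add_sub_cancel, factorial_succ_sub, psNumer_succ']
  push_cast
  rw [add_sub_cancel_right, norm_mul, norm_pow, norm_two]
  have := norm_natCast_le_one (psNumer 2 M)
  calc (1 / 2 : ℝ) ^ (M * M !) * ‖(psNumer 2 M : PadicAlgCl 2)‖ ≤ (1 / 2 : ℝ) ^ (M * M !) * 1 := by gcongr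
    _ = _ := by rw [mul_one]

/-- **Step 2** (the 2-adic expansion feeding `core`): with `u = 2^t·r` (a 2-adic unit),
`‖lc A · u · (u^e − γ) + 2^t·(c₁u^e + c₂)‖₂ ≤ M·(4^{−t} + 2^{−(N! − (N−1)!)})`. -/
theorem expansion_bound (A B : ℤ[X]) (he : B.natDegree + 2 ≤ A.natDegree) :
    ∃ M : ℝ, 0 < M ∧ ∀ {N : ℕ}, 2 ≤ N → ∀ {r : ℚ}, OnLevel A B N r → aeval r A ≠ 0 → aeval r B ≠ 0 →
      tee0 A B < padicValNat 2 r.den →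
      ‖(((2 : ℚ) ^ padicValNat 2 r.den * r : ℚ) : PadicAlgCl 2)‖ = 1 ∧
      ‖(A.leadingCoeff : PadicAlgCl 2) * (((2 : ℚ) ^ padicValNat 2 r.den * r : ℚ) : PadicAlgCl 2)
          * ((((2 : ℚ) ^ padicValNat 2 r.den * r : ℚ) : PadicAlgCl 2) ^ gap A B - (gam A B : PadicAlgCl 2))
        + (2 : PadicAlgCl 2) ^ padicValNat 2 r.den
          * ((cee1 A : PadicAlgCl 2) * (((2 : ℚ) ^ padicValNat 2 r.den * r : ℚ) : PadicAlgCl 2) ^ gap A B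
            + (cee2 A B : PadicAlgCl 2))‖
        ≤ M * ((1 / 4 : ℝ) ^ padicValNat 2 r.den + (1 / 2 : ℝ) ^ (Nat.factorial N - Nat.factorial (N - 1))) := by
  have hA0 : A ≠ 0 := by rintro rfl; simp at he
  have ha : A.leadingCoeff ≠ 0 := leadingCoeff_ne_zero.mpr hA0
  refine ⟨1 + ‖(2 : PadicAlgCl 2) ^ kap A B‖, by positivity, ?_⟩
  intro N hN r hpt hAr hBr ht
  have hB0 : B ≠ 0 := by rintro rfl; simp at hBr
  have hb : B.leadingCoeff ≠ 0 := leadingCoeff_ne_zero.mpr hB0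
  have hdeg : B.natDegree < A.natDegree := by omega
  set t := padicValNat 2 r.den with ht_def
  have ht1 : 1 ≤ t := by omega
  set a := A.natDegree with ha_def
  set b := B.natDegree with hb_def
  set e := gap A B with he_def
  have hea : e + b = a := by rw [he_def, gap]; omega
  set κ := kap A B with hκ_def
  -- the unit `u`
  have hu_cast : ((((2 : ℚ) ^ t * r : ℚ)) : PadicAlgCl 2) = (2 : PadicAlgCl 2) ^ t * (r : PadicAlgCl 2) := by
    push_cast; rfl
  set u : PadicAlgCl 2 := (2 : PadicAlgCl 2) ^ t * (r : PadicAlgCl 2) with hu_def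
  rw [hu_cast]
  have hu : ‖u‖ = 1 := by
    rw [hu_def, norm_mul, norm_pow, norm_two, norm_ratCast_of_le ht1, ← ht_def, ← mul_pow]
    norm_num
  refine ⟨hu, ?_⟩
  -- the point equation in `\overline{ℚ₂}`
  have hK : (aeval (r : PadicAlgCl 2) A) * (2 : PadicAlgCl 2) ^ N ! +
      (psNumer 2 N : PadicAlgCl 2) * aeval (r : PadicAlgCl 2) B = 0 := by
    have h1 : aeval r A * (2 : ℚ) ^ N ! + (psNumer 2 N : ℚ) * aeval r B = 0 := by
      unfold OnLevel at hpt
      field_simp at hpt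
      linarith [hpt]
    have h2 := congrArg (Rat.cast : ℚ → PadicAlgCl 2) h1
    push_cast at h2
    rwa [aeval_ratCast, aeval_ratCast] at h2
  -- `2^{te} = 2^{N!} · 2^κ`
  have hval := val_relation A B hdeg hN hpt hAr hBr ht
  have h2pow : (2 : PadicAlgCl 2) ^ (t * e) = (2 : PadicAlgCl 2) ^ N ! * (2 : PadicAlgCl 2) ^ κ := by
    rw [← zpow_natCast, ← zpow_natCast, ← zpow_add₀ (two_ne_zero), show ((t * e : ℕ) : ℤ) = (N ! : ℤ) + κ from by
      rw [mul_comm]; exact_mod_cast hval]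
  -- the expansions of `F = Y·A` and `G = Y·B`
  set F : ℤ[X] := X * A with hF
  set G : ℤ[X] := X * B with hG
  have hFdeg : F.natDegree ≤ a + 1 := by
    rw [hF]; exact (natDegree_mul_le).trans (by rw [natDegree_X, ha_def]; omega)
  have hGdeg : G.natDegree ≤ b + 1 := by
    rw [hG]; exact (natDegree_mul_le).trans (by rw [natDegree_X, hb_def]; omega)
  have hSA := expand_eq F hFdeg (r : PadicAlgCl 2) t
  have hSB := expand_eq G hGdeg (r : PadicAlgCl 2) t
  rw [← hu_def] at hSA hSB
  set SA := ∑ i ∈ Finset.range (a + 1 + 1), (F.coeff i : PadicAlgCl 2) * u ^ i *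
    (2 : PadicAlgCl 2) ^ (t * (a + 1 - i)) with hSA_def
  set SB := ∑ i ∈ Finset.range (b + 1 + 1), (G.coeff i : PadicAlgCl 2) * u ^ i *
    (2 : PadicAlgCl 2) ^ (t * (b + 1 - i)) with hSB_def
  have hFr : aeval (r : PadicAlgCl 2) F = r * aeval (r : PadicAlgCl 2) A := by rw [hF, map_mul, aeval_X]
  have hGr : aeval (r : PadicAlgCl 2) G = r * aeval (r : PadicAlgCl 2) B := by rw [hG, map_mul, aeval_X]
  -- the identity `SA + p·2^κ·SB = 0`
  have hid : SA + (psNumer 2 N : PadicAlgCl 2) * (2 : PadicAlgCl 2) ^ κ * SB = 0 := by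
    have h2N : (2 : PadicAlgCl 2) ^ N ! ≠ 0 := pow_ne_zero _ two_ne_zero
    have hta : (2 : PadicAlgCl 2) ^ (t * (a + 1)) = (2 : PadicAlgCl 2) ^ (t * e) * (2 : PadicAlgCl 2) ^ (t * (b + 1)) := by
      rw [← pow_add]; congr 1; rw [← hea]; ring
    have h3 : (2 : PadicAlgCl 2) ^ N ! * (SA + (psNumer 2 N : PadicAlgCl 2) * (2 : PadicAlgCl 2) ^ κ * SB) = 0 := by
      rw [← hSA, ← hSB, hFr, hGr, hta, h2pow]
      linear_combination (2 : PadicAlgCl 2) ^ N ! * (2 : PadicAlgCl 2) ^ κ * (2 : PadicAlgCl 2) ^ (t * (b + 1)) *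
        (r : PadicAlgCl 2) * hK
    exact (mul_eq_zero.mp h3).resolve_left h2N
  -- the two-term truncations
  have hapA := approx_two F (n := a + 1) (by omega) u hu.le t
  have hapB := approx_two G (n := b + 1) (by omega) u hu.le t
  rw [← hSA_def] at hapA
  rw [← hSB_def] at hapB
  have hFtop : F.coeff (a + 1) = A.leadingCoeff := by rw [hF, coeff_X_mul]; rfl
  have hFsec : F.coeff (a + 1 - 1) = A.coeff (a - 1) := by
    obtain ⟨a', ha'⟩ : ∃ a', a = a' + 1 := ⟨a - 1, by omega⟩
    rw [Nat.add_sub_cancel, ha', hF, coeff_X_mul, Nat.add_sub_cancel]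
  have hGtop : G.coeff (b + 1) = B.leadingCoeff := by rw [hG, coeff_X_mul]; rfl
  rw [hFtop, hFsec, Nat.add_sub_cancel] at hapA
  rw [hGtop, Nat.add_sub_cancel] at hapB
  -- constants
  have hc1 : (cee1 A : PadicAlgCl 2) = (A.coeff (a - 1) : PadicAlgCl 2) := by simp [cee1, ha_def]
  have hc2 : (cee2 A B : PadicAlgCl 2) = (2 : PadicAlgCl 2) ^ κ * (G.coeff b : PadicAlgCl 2) := by
    simp [cee2, hκ_def, hG, hb_def]
  have hγ : (A.leadingCoeff : PadicAlgCl 2) * (gam A B : PadicAlgCl 2) =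
      -((2 : PadicAlgCl 2) ^ κ * (B.leadingCoeff : PadicAlgCl 2)) := by
    have haK : (A.leadingCoeff : PadicAlgCl 2) ≠ 0 := by exact_mod_cast ha
    simp only [gam, hκ_def]
    push_cast
    field_simp
  -- main terms
  set mainA := (A.leadingCoeff : PadicAlgCl 2) * u ^ (a + 1) + (2 : PadicAlgCl 2) ^ t * (A.coeff (a - 1) : PadicAlgCl 2) * u ^ a
    with hmainA
  set mainB := (B.leadingCoeff : PadicAlgCl 2) * u ^ (b + 1) + (2 : PadicAlgCl 2) ^ t * (G.coeff b : PadicAlgCl 2) * u ^ b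
    with hmainB
  have hpow1 : u * u ^ e * u ^ b = u ^ (a + 1) := by
    rw [← pow_succ', ← pow_add]; congr 1; omega
  have hpow2 : u ^ e * u ^ b = u ^ a := by rw [← pow_add, hea]
  have hpow3 : u * u ^ b = u ^ (b + 1) := by rw [pow_succ']
  -- `Φ · u^b = mainA + 2^κ mainB =: Φ1`
  have hΦ1 : ((A.leadingCoeff : PadicAlgCl 2) * u * (u ^ e - (gam A B : PadicAlgCl 2)) +
      (2 : PadicAlgCl 2) ^ t * ((cee1 A : PadicAlgCl 2) * u ^ e + (cee2 A B : PadicAlgCl 2))) * u ^ b =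
      (mainA - SA) + (psNumer 2 N : PadicAlgCl 2) * (2 : PadicAlgCl 2) ^ κ * (mainB - SB)
        - ((psNumer 2 N : PadicAlgCl 2) - 1) * (2 : PadicAlgCl 2) ^ κ * mainB := by
    rw [hc1, hc2, hmainA, hmainB]
    linear_combination (A.leadingCoeff : PadicAlgCl 2) * hpow1 + (-(u * u ^ b)) * hγ
      + (2 : PadicAlgCl 2) ^ t * (A.coeff (a - 1) : PadicAlgCl 2) * hpow2
      + (2 : PadicAlgCl 2) ^ κ * (B.leadingCoeff : PadicAlgCl 2) * hpow3 + hid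
  have hnorm_eq : ‖(A.leadingCoeff : PadicAlgCl 2) * u * (u ^ e - (gam A B : PadicAlgCl 2)) +
      (2 : PadicAlgCl 2) ^ t * ((cee1 A : PadicAlgCl 2) * u ^ e + (cee2 A B : PadicAlgCl 2))‖ =
      ‖(mainA - SA) + (psNumer 2 N : PadicAlgCl 2) * (2 : PadicAlgCl 2) ^ κ * (mainB - SB)
        - ((psNumer 2 N : PadicAlgCl 2) - 1) * (2 : PadicAlgCl 2) ^ κ * mainB‖ := by
    rw [← hΦ1, norm_mul, norm_pow, hu, one_pow, mul_one]
  rw [hnorm_eq]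
  -- bounds
  have hp : ‖(psNumer 2 N : PadicAlgCl 2)‖ = 1 := by
    have := norm_intCast_of_odd (m := (psNumer 2 N : ℤ)) (by exact_mod_cast psNumer_two_odd hN)
    simpa using this
  have hp1 := norm_psNumer_sub_one (N := N) (by omega)
  have hmainB : ‖mainB‖ ≤ 1 := by
    rw [hmainB]
    refine (IsUltrametricDist.norm_add_le_max _ _).trans (max_le ?_ ?_)
    · rw [norm_mul, norm_pow, hu, one_pow, mul_one]; exact norm_intCast_le_one' _
    · rw [norm_mul, norm_mul, norm_pow, norm_pow, hu, one_pow, mul_one, norm_two]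
      calc (1 / 2 : ℝ) ^ t * ‖(G.coeff b : PadicAlgCl 2)‖ ≤ 1 * 1 := by
            gcongr
            · exact pow_le_one₀ (by norm_num) (by norm_num)
            · exact norm_intCast_le_one' _
        _ = 1 := by ring
  have hA' : ‖mainA - SA‖ ≤ (1 / 4 : ℝ) ^ t := by rw [norm_sub_rev]; exact hapA
  have hB' : ‖mainB - SB‖ ≤ (1 / 4 : ℝ) ^ t := by rw [norm_sub_rev]; exact hapB
  set q := ‖(2 : PadicAlgCl 2) ^ κ‖ with hq
  have hq0 : 0 ≤ q := norm_nonneg _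
  calc ‖(mainA - SA) + (psNumer 2 N : PadicAlgCl 2) * (2 : PadicAlgCl 2) ^ κ * (mainB - SB)
        - ((psNumer 2 N : PadicAlgCl 2) - 1) * (2 : PadicAlgCl 2) ^ κ * mainB‖
      ≤ ‖mainA - SA‖ + ‖(psNumer 2 N : PadicAlgCl 2) * (2 : PadicAlgCl 2) ^ κ * (mainB - SB)‖
        + ‖((psNumer 2 N : PadicAlgCl 2) - 1) * (2 : PadicAlgCl 2) ^ κ * mainB‖ :=
          (norm_sub_le _ _).trans (by gcongr; exact norm_add_le _ _)
    _ = ‖mainA - SA‖ + q * ‖mainB - SB‖ + ‖(psNumer 2 N : PadicAlgCl 2) - 1‖ * q * ‖mainB‖ := by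
        rw [norm_mul, norm_mul, norm_mul, norm_mul, hp, one_mul]
    _ ≤ (1 / 4 : ℝ) ^ t + q * (1 / 4 : ℝ) ^ t + (1 / 2 : ℝ) ^ (Nat.factorial N - Nat.factorial (N - 1)) * q * 1 := by
        gcongr
    _ ≤ (1 + q) * ((1 / 4 : ℝ) ^ t + (1 / 2 : ℝ) ^ (Nat.factorial N - Nat.factorial (N - 1))) := by
        have h14 : (0 : ℝ) ≤ (1 / 4 : ℝ) ^ t := by positivity
        have h12 : (0 : ℝ) ≤ (1 / 2 : ℝ) ^ (Nat.factorial N - Nat.factorial (N - 1)) := by positivity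
        nlinarith

/-- **Step 6** (finite-to-one): a FIXED shifted value `ρ₀` at infinitely many levels forces the common rational
root `−θ` of `A` and `B` (archimedean limit + irrationality of `ℓ₂`). -/
theorem common_root_of_fixed_value (A B : ℤ[X]) (ρ₀ θ : ℚ) {e : ℕ} (he : 1 ≤ e) (κ : ℤ) (S : Set ℕ) (hS : S.Infinite)
    (hS' : ∀ N ∈ S, ∃ t : ℕ, ((e * t : ℕ) : ℤ) = (N ! : ℕ) + κ ∧ OnLevel A B N (ρ₀ / 2 ^ t - θ)) :
    aeval (-θ) A = 0 ∧ aeval (-θ) B = 0 := by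
  by_contra hne
  set α : ℚ := aeval (-θ) A with hα_def
  set β : ℚ := aeval (-θ) B with hβ_def
  set L : ℝ := (α : ℝ) + liouvilleNumber 2 * β with hL
  have hL0 : L ≠ 0 := by
    intro h0
    by_cases hβ : β = 0
    · have hα : α ≠ 0 := fun hα => hne ⟨hα, hβ⟩
      rw [hL, hβ] at h0
      push_cast at h0
      simp only [mul_zero, add_zero, Rat.cast_eq_zero] at h0
      exact hα h0
    · have hirr : Irrational (liouvilleNumber 2) :=
        (liouville_liouvilleNumber (by norm_num : 1 < (2 : ℕ))).irrational
      apply hirr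
      refine ⟨-α / β, ?_⟩
      have hβR : (β : ℝ) ≠ 0 := by exact_mod_cast hβ
      push_cast
      field_simp
      linarith [h0]
  -- continuity of `g(x) = A(x) + ℓ₂ B(x)` and of `B` at `-θ`
  set g : ℝ → ℝ := fun x => aeval x A + liouvilleNumber 2 * aeval x B with hg_def
  have hg : Continuous g :=
    (Polynomial.continuous_aeval A).add (continuous_const.mul (Polynomial.continuous_aeval B))
  have hθA : aeval (((-θ : ℚ)) : ℝ) A = (α : ℝ) := by rw [hα_def, aeval_ratCast]
  have hθB : aeval (((-θ : ℚ)) : ℝ) B = (β : ℝ) := by rw [hβ_def, aeval_ratCast]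
  have hgθ : g (((-θ : ℚ)) : ℝ) = L := by
    simp only [hg_def, hL, hθA, hθB]
  have hLpos : 0 < |L| / 2 := by positivity
  obtain ⟨δ, hδ, hδg⟩ := Metric.continuous_iff.mp hg (((-θ : ℚ)) : ℝ) (|L| / 2) hLpos
  obtain ⟨δ', hδ', hδB⟩ := Metric.continuous_iff.mp (Polynomial.continuous_aeval B) (((-θ : ℚ)) : ℝ) 1 one_pos
  -- thresholds
  obtain ⟨T, hT⟩ := exists_pow_lt_of_lt_one (show 0 < min δ δ' / (|(ρ₀ : ℝ)| + 1) by positivity)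
    (show (1 / 2 : ℝ) < 1 by norm_num)
  obtain ⟨N₁, hN₁⟩ := exists_pow_lt_of_lt_one (show 0 < |L| / 2 / (2 * (|(β : ℝ)| + 1)) by positivity)
    (show (1 / 2 : ℝ) < 1 by norm_num)
  obtain ⟨N, hNS, hNbig⟩ := hS.exists_gt (e * T + κ.natAbs + N₁)
  obtain ⟨t, het, hpt⟩ := hS' N hNS
  -- `t ≥ T`
  have htT : T ≤ t := by
    have h1 : (N : ℤ) ≤ (N ! : ℕ) := by exact_mod_cast Nat.self_le_factorial N
    have h3 : ((e * T + κ.natAbs + N₁ : ℕ) : ℤ) < N := by exact_mod_cast hNbig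
    have h4 : (κ.natAbs : ℤ) = |κ| := Int.natCast_natAbs κ
    have h5 := neg_abs_le κ
    push_cast at het h3
    have h2 : (e : ℤ) * T ≤ e * t := by linarith
    have h2' : e * T ≤ e * t := by exact_mod_cast h2
    exact Nat.le_of_mul_le_mul_left h2' (by omega)
  -- the point and its distance to `-θ`
  set r : ℚ := ρ₀ / 2 ^ t - θ with hr_def
  have hdist : dist ((r : ℚ) : ℝ) (((-θ : ℚ)) : ℝ) < min δ δ' := by
    rw [Real.dist_eq, hr_def]
    push_cast
    rw [show (ρ₀ : ℝ) / 2 ^ t - θ - -(θ : ℝ) = ρ₀ * (1 / 2) ^ t by rw [one_div, inv_pow, div_eq_mul_inv]; ring,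
      abs_mul,
      abs_of_pos (by positivity : (0 : ℝ) < (1 / 2) ^ t)]
    have hρ : |(ρ₀ : ℝ)| < |(ρ₀ : ℝ)| + 1 := by linarith
    have hTt : (1 / 2 : ℝ) ^ t ≤ (1 / 2) ^ T := pow_le_pow_of_le_one (by norm_num) (by norm_num) htT
    calc |(ρ₀ : ℝ)| * (1 / 2 : ℝ) ^ t ≤ |(ρ₀ : ℝ)| * (1 / 2) ^ T := by gcongr
      _ ≤ (|(ρ₀ : ℝ)| + 1) * (1 / 2) ^ T := mul_le_mul_of_nonneg_right hρ.le (by positivity)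
      _ < (|(ρ₀ : ℝ)| + 1) * (min δ δ' / (|(ρ₀ : ℝ)| + 1)) := by gcongr
      _ = min δ δ' := by field_simp
  have hdδ : dist ((r : ℚ) : ℝ) (((-θ : ℚ)) : ℝ) < δ := lt_of_lt_of_le hdist (min_le_left _ _)
  have hdδ' : dist ((r : ℚ) : ℝ) (((-θ : ℚ)) : ℝ) < δ' := lt_of_lt_of_le hdist (min_le_right _ _)
  -- the point equation over `ℝ` and the value `g(r) = remainder · B(r)`
  have hreal : aeval ((r : ℚ) : ℝ) A + partialSum 2 N * aeval ((r : ℚ) : ℝ) B = 0 := by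
    have h1 := congrArg (Rat.cast : ℚ → ℝ) hpt
    unfold OnLevel at hpt
    have h2 := congrArg (Rat.cast : ℚ → ℝ) hpt
    push_cast at h2
    rw [aeval_ratCast, aeval_ratCast] at h2
    rw [partialSum_two]
    exact h2
  have hgr : g ((r : ℚ) : ℝ) = remainder 2 N * aeval ((r : ℚ) : ℝ) B := by
    simp only [hg_def]
    rw [ell2_eq N]
    linarith [hreal]
  -- bounds
  have hBr : |aeval ((r : ℚ) : ℝ) B| < |(β : ℝ)| + 1 := by
    have := hδB _ hdδ'
    rw [Real.dist_eq, hθB] at this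
    have := abs_sub_abs_le_abs_sub (aeval ((r : ℚ) : ℝ) B) (β : ℝ)
    linarith
  have hrem : remainder 2 N ≤ 2 * (1 / 2 : ℝ) ^ N₁ := by
    have h1 := remainder_two_lt N
    have h2 : (2 : ℝ) / 2 ^ (N + 1)! ≤ 2 * (1 / 2 : ℝ) ^ N₁ := by
      rw [div_eq_mul_inv, ← inv_pow, ← one_div]
      exact mul_le_mul_of_nonneg_left (pow_le_pow_of_le_one (by norm_num) (by norm_num)
        ((show N₁ ≤ N + 1 by omega).trans (Nat.self_le_factorial _))) (by norm_num)
    linarith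
  have hrem0 : 0 ≤ remainder 2 N := (remainder_pos (by norm_num) N).le
  have hg_small : |g ((r : ℚ) : ℝ)| < |L| / 2 := by
    rw [hgr, abs_mul, abs_of_nonneg hrem0]
    calc remainder 2 N * |aeval ((r : ℚ) : ℝ) B| ≤ 2 * (1 / 2 : ℝ) ^ N₁ * (|(β : ℝ)| + 1) := by
          gcongr
        _ < 2 * (|L| / 2 / (2 * (|(β : ℝ)| + 1))) * (|(β : ℝ)| + 1) := by gcongr
        _ = |L| / 2 := by field_simp
  have hg_close : |g ((r : ℚ) : ℝ) - L| < |L| / 2 := by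
    have := hδg _ hdδ
    rwa [Real.dist_eq, hgθ] at this
  have := abs_sub_abs_le_abs_sub L (g ((r : ℚ) : ℝ))
  rw [abs_sub_comm] at this
  linarith

end Summit.Schanuel.Schanuel.Theorems.RootDecomp1KXLinear

end
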